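import Summits.ABC.ABC.Theorems.FeketeScalesSubmultOfRST

/-!
# Crux `ScaleSubmultiplicativity` (stmt-ABC-2160): monotone record quality implies the crux

The crux-strategist's census (`Cruxes/ScaleSubmultiplicativity/STRATEGY-CENSUS.md` §S3, typed as
`Strategist.MonotoneRecordQuality` in `Cruxes/ScaleSubmultiplicativity/StrategySplit.lean`) records the pure
"regularity" strengthening of the crux — MONOTONE RECORD QUALITY (BarrierNotes-r1-k1 §7(b)), G-free:

> `∃ θ < 1, ∃ C, ∃ R₀, ∀ R₀ ≤ R ≤ R', ∀ abc triple T' with rad T' ≤ R', ∃ abc triple T with rad T ≤ R and`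
> `log c' / log R' ≤ log c / log R + C (log R)^{θ-1}`

(the best `log c / log R` over `rad ≤ R` is quasi-non-increasing in the scale), with the remark "implies the crux (two
lines in G-form)".  This file makes that remark a kernel fact:

* `ScaleSubmultiplicativity.of_monotoneRecordQuality` : MonotoneRecordQuality (inlined) → `ScaleSubmultiplicativity`.

Proof (the two lines).  For `R₁, R₂ ≥ R₀` and `T'` with `rad T' ≤ R₁R₂ =: R'` apply the hypothesis at `(R₁, R')` and at
`(R₂, R')`: shadows `T₁`, `T₂` with `log c'/L ≤ log cᵢ/Lᵢ + C Lᵢ^{θ-1}` (`Lᵢ = log Rᵢ`, `L = L₁ + L₂`); multiplying by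
`Lᵢ` and adding, `log c' ≤ log c₁ + log c₂ + C (L₁^θ + L₂^θ) ≤ log c₁c₂ + 2|C| L^{θ⁺}`, and `2|C| L^{θ⁺} ≤ L^{(1+θ⁺)/2}`
above a threshold (`SubmultOfRST.exists_threshold`); so the crux holds with `θ' = (1+θ⁺)/2`, `K = 1`.
So `MonotoneRecordQuality ⟹ crux ⟹ record saturation` (`…RecordSaturation.lean`: the running-max version, with the
quality `log c/log rad` in place of `log c/log R`), bracketing stmt-ABC-2160 between two monotonicity statements about
abc records.  A kernel fact ABOUT the crux (`--supports stmt-ABC-2160`); MonotoneRecordQuality itself is open and, by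
the census, no easier than the crux.  Pattern: folklore (sub-additivity from monotone averages; Pólya–Szegő I.98).
-/

-- `Summit.<Summit>.<Problem>` is the mandated summit-side namespace (CONVENTIONS §2); for the
-- single-conjunct summit `ABC` the two coincide, so the duplicate `ABC.ABC` is deliberate.
set_option linter.dupNamespace false

namespace Summit.ABC.ABC.Theorems

open Literature.NumberTheory.DiophantineGeometry
open Summit.ABC.ABC.Theses.FeketeScales

namespace ScaleSubmultiplicativity.OfMonotoneRecordQuality

/-- One half of the two-line argument: from `log c'/L ≤ log c₁/L₁ + C L₁^{θ-1}` with `L₁ ≥ 1`, `θ ≤ t`, `0 ≤ t`,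
`L₁ ≤ L`: `L₁ · (log c'/L) ≤ log c₁ + |C| L^t`. [folklore] -/
theorem half_bound {x y L L₁ C θ t : ℝ} (hL₁ : 1 ≤ L₁) (hL₁L : L₁ ≤ L) (hθt : θ ≤ t) (ht0 : 0 ≤ t)
    (h : x / L ≤ y / L₁ + C * L₁ ^ (θ - 1)) :
    L₁ * (x / L) ≤ y + |C| * L ^ t := by
  have hL₁0 : 0 < L₁ := by linarith
  have hmul := mul_le_mul_of_nonneg_left h hL₁0.le
  have e1 : L₁ * (y / L₁ + C * L₁ ^ (θ - 1)) = y + C * (L₁ ^ (θ - 1) * L₁) := by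
    field_simp
  have e2 : L₁ ^ (θ - 1) * L₁ = L₁ ^ θ := by
    calc L₁ ^ (θ - 1) * L₁ = L₁ ^ (θ - 1) * L₁ ^ (1 : ℝ) := by rw [Real.rpow_one]
      _ = L₁ ^ (θ - 1 + 1) := (Real.rpow_add hL₁0 _ _).symm
      _ = L₁ ^ θ := by ring_nf
  rw [e1, e2] at hmul
  have hθ : L₁ ^ θ ≤ L ^ t :=
    calc L₁ ^ θ ≤ L₁ ^ t := Real.rpow_le_rpow_of_exponent_le hL₁ hθt
      _ ≤ L ^ t := Real.rpow_le_rpow hL₁0.le hL₁L ht0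
  have hC : C * L₁ ^ θ ≤ |C| * L ^ t :=
    calc C * L₁ ^ θ ≤ |C| * L₁ ^ θ := mul_le_mul_of_nonneg_right (le_abs_self C) (Real.rpow_nonneg hL₁0.le θ)
      _ ≤ |C| * L ^ t := mul_le_mul_of_nonneg_left hθ (abs_nonneg C)
  linarith

end ScaleSubmultiplicativity.OfMonotoneRecordQuality

open ScaleSubmultiplicativity.OfMonotoneRecordQuality

/-- **Monotone record quality implies the crux** (census §S3 made a kernel fact).  If for some `θ < 1`, `C`, `R₀`,
for all scales `R₀ ≤ R ≤ R'` every abc triple `T'` of radical `≤ R'` admits an abc triple `T` of radical `≤ R` with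
`log c'/log R' ≤ log c/log R + C (log R)^{θ-1}`, then `ScaleSubmultiplicativity` (stmt-ABC-2160) holds, with
`θ' = (1 + max θ 0)/2`, `K = 1` and threshold `max (max R₀ 3) N₀`. [folklore] -/
theorem ScaleSubmultiplicativity.of_monotoneRecordQuality :
    (∃ θ : ℝ, θ < 1 ∧ ∃ C : ℝ, ∃ R₀ : ℕ, ∀ R R' : ℕ, R₀ ≤ R → R ≤ R' →
      ∀ a' b' c' : ℕ, IsABCTriple a' b' c' → rad a' b' c' ≤ R' →
      ∃ a b c : ℕ, IsABCTriple a b c ∧ rad a b c ≤ R ∧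
        Real.log c' / Real.log R' ≤ Real.log c / Real.log R + C * Real.log R ^ (θ - 1)) →
    Summit.ABC.ABC.Theses.FeketeScales.ScaleSubmultiplicativity := by
  rintro ⟨θ, hθ1, C, R₀, hM⟩
  set t : ℝ := max θ 0 with ht_def
  have ht0 : 0 ≤ t := le_max_right _ _
  have ht1 : t < 1 := max_lt hθ1 one_pos
  have hθt : θ ≤ t := le_max_left _ _
  set s : ℝ := (1 - t) / 2 with hs_def
  have hs : 0 < s := by rw [hs_def]; linarith
  obtain ⟨N₀, hN₀⟩ := SubmultOfRST.exists_threshold (2 * |C|) hs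
  refine ⟨(1 + t) / 2, by linarith, 1, one_pos, max (max R₀ 3) N₀, ?_⟩
  intro R₁ R₂ hR₁ hR₂ a' b' c' hT' hrad
  have hR₀₁ : R₀ ≤ R₁ := le_trans (le_trans (le_max_left _ _) (le_max_left _ _)) hR₁
  have hR₀₂ : R₀ ≤ R₂ := le_trans (le_trans (le_max_left _ _) (le_max_left _ _)) hR₂
  have h3R₁ : 3 ≤ R₁ := le_trans (le_trans (le_max_right _ _) (le_max_left _ _)) hR₁
  have h3R₂ : 3 ≤ R₂ := le_trans (le_trans (le_max_right _ _) (le_max_left _ _)) hR₂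
  have hN₀R : N₀ ≤ R₁ * R₂ := ((le_max_right _ _).trans hR₁).trans (Nat.le_mul_of_pos_right _ (by omega))
  -- the two applications of the hypothesis
  obtain ⟨a₁, b₁, c₁, h₁, hr₁, hq₁⟩ :=
    hM R₁ (R₁ * R₂) hR₀₁ (Nat.le_mul_of_pos_right _ (by omega)) a' b' c' hT' hrad
  obtain ⟨a₂, b₂, c₂, h₂, hr₂, hq₂⟩ :=
    hM R₂ (R₁ * R₂) hR₀₂ (Nat.le_mul_of_pos_left _ (by omega)) a' b' c' hT' hrad
  refine ⟨a₁, b₁, c₁, a₂, b₂, c₂, h₁, hr₁, h₂, hr₂, ?_⟩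
  -- logarithms of the scales
  have hR₁pos : (0 : ℝ) < R₁ := by exact_mod_cast (show 0 < R₁ by omega)
  have hR₂pos : (0 : ℝ) < R₂ := by exact_mod_cast (show 0 < R₂ by omega)
  have h3R₁' : (3 : ℝ) ≤ R₁ := by exact_mod_cast h3R₁
  have h3R₂' : (3 : ℝ) ≤ R₂ := by exact_mod_cast h3R₂
  -- `log Rᵢ ≥ 1` since `Rᵢ ≥ 3 > e` (cf. `LWMeasure.one_le_log_of_three_le`)
  have hL₁ : 1 ≤ Real.log (R₁ : ℝ) := by
    rw [Real.le_log_iff_exp_le hR₁pos]; exact Real.exp_one_lt_three.le.trans h3R₁'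
  have hL₂ : 1 ≤ Real.log (R₂ : ℝ) := by
    rw [Real.le_log_iff_exp_le hR₂pos]; exact Real.exp_one_lt_three.le.trans h3R₂'
  have hcast : ((R₁ * R₂ : ℕ) : ℝ) = (R₁ : ℝ) * R₂ := by push_cast; ring
  have hL : Real.log ((R₁ : ℝ) * R₂) = Real.log R₁ + Real.log R₂ := Real.log_mul hR₁pos.ne' hR₂pos.ne'
  rw [hcast] at hq₁ hq₂
  have hL₁L : Real.log (R₁ : ℝ) ≤ Real.log ((R₁ : ℝ) * R₂) := by rw [hL]; linarith
  have hL₂L : Real.log (R₂ : ℝ) ≤ Real.log ((R₁ : ℝ) * R₂) := by rw [hL]; linarith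
  have hLpos : 0 < Real.log ((R₁ : ℝ) * R₂) := by rw [hL]; linarith
  -- the two half bounds and their sum
  have e₁ := half_bound hL₁ hL₁L hθt ht0 hq₁
  have e₂ := half_bound hL₂ hL₂L hθt ht0 hq₂
  have hsum : Real.log c' ≤ Real.log c₁ + Real.log c₂ + 2 * |C| * Real.log ((R₁ : ℝ) * R₂) ^ t := by
    have e : Real.log (R₁ : ℝ) * (Real.log c' / Real.log ((R₁ : ℝ) * R₂)) +
        Real.log (R₂ : ℝ) * (Real.log c' / Real.log ((R₁ : ℝ) * R₂)) = Real.log c' := by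
      rw [← add_mul, ← hL, mul_div_cancel₀ _ hLpos.ne']
    linarith
  -- absorb `2|C| L^t` into `L^{(1+t)/2}` above the threshold `N₀`
  have hthr : 2 * |C| ≤ Real.log ((R₁ : ℝ) * R₂) ^ s := by
    have := hN₀ (R₁ * R₂) hN₀R
    rwa [hcast] at this
  have habs : 2 * |C| * Real.log ((R₁ : ℝ) * R₂) ^ t ≤ Real.log ((R₁ : ℝ) * R₂) ^ ((1 + t) / 2) := by
    have hsum' : (1 + t) / 2 = s + t := by rw [hs_def]; ring
    rw [hsum', Real.rpow_add hLpos]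
    exact mul_le_mul_of_nonneg_right hthr (Real.rpow_nonneg hLpos.le t)
  -- exponentiate
  have hc'pos : (0 : ℝ) < c' := by exact_mod_cast lt_of_lt_of_le two_pos hT'.two_le
  have hc₁pos : (0 : ℝ) < c₁ := by exact_mod_cast lt_of_lt_of_le two_pos h₁.two_le
  have hc₂pos : (0 : ℝ) < c₂ := by exact_mod_cast lt_of_lt_of_le two_pos h₂.two_le
  have hEpos : 0 < Real.exp (Real.log ((R₁ : ℝ) * R₂) ^ ((1 + t) / 2)) := Real.exp_pos _
  have hlog : Real.log c' ≤
      Real.log (1 * Real.exp (Real.log ((R₁ : ℝ) * R₂) ^ ((1 + t) / 2)) * c₁ * c₂) := by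
    rw [one_mul, Real.log_mul (by positivity) hc₂pos.ne', Real.log_mul hEpos.ne' hc₁pos.ne', Real.log_exp]
    linarith
  exact (Real.log_le_log_iff hc'pos (by positivity)).mp hlog

end Summit.ABC.ABC.Theorems
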